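import Literature.AlgebraicGeometry.Modules.SerreTwistHyperplaneClass
import Literature.AlgebraicGeometry.Modules.SerreTwistHom
import Literature.AlgebraicGeometry.Modules.SerreTwistModProjMap
import Literature.AlgebraicGeometry.Motives.HyperplaneDivisorOfClosedImmersion
import Literature.AlgebraicGeometry.Motives.ProjectiveSpaceSections
import HarnessLib

/-!
# `𝒪_Y(1) ≅ 𝒪_Y(Θ)` with `Θ` ample, for an affine morphism `Y → 𝐏ᵈ_K` — and the fibre form for a family `Z ⊂ 𝐏ʳ_K`

Topic `Literature/AlgebraicGeometry/Modules`; namespace `Literature.AlgebraicGeometry.Modules.SerreTwist`; universe `u`;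
theorems only (no `def`, no instance, no notation, no named fact, no `sorry`).  Cell hodgecm-mathlib, F-DAG F-6, brick (R-L)(L2)
of the (H-rep) road: the FIBREWISE-AMPLENESS premise `hamp₂` of ★ `AbelianSchemes/MFKSubfunctorOfHilb`
(`exists_isImmersion_iff_mfkSubfunctor`: «for every geometric point `s` of `H₂` there is an ample Cartier divisor `Θ` on the
fibre with `L₀|_{A_s} ≅ 𝒪(Θ)`», `lineBundleOfDivisor := Modules.lineBundle Θ.toUnitCocycle`) is discharged, at the Hilbert-scheme
instantiation `L₀ := 𝒪_{Z₀}(1) = twistMod ι₀ 𝒪 1`, by the square form §3 below.  HC_CM is proved only modulo the 7 printed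
citations until rung 0 closes; nothing here bears on a summit statement.

The three dialects of `𝒪(1)` in the tree meet here: the POSITIVE Serre twist `twistMod ι 𝒪_Y 1` (★ `Modules/SerreTwistMod`,
[Hartshorne1977] II Prop. 5.12), the dual `(serreTwist ι 1)^∨` of the NEGATIVE twist (★ `Modules/SerreTwist`, ★
`SerreTwist.sheafHomTwistIso`: `𝓗om(𝒪(-1), 𝒪) ≅ 𝒪(1)`), and the line bundle `𝒪(H)` of the hyperplane Cartier divisor (★
`Motives/ProjectiveSpaceSections`: `ProjSpace.hyperplane d K = div(x₀)`, ★ `SerreTwist.nonempty_dual_serreTwist_iso_lineBundle`: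
`𝒪(m) ≅ 𝒪(m·H_ι)` on an integral scheme).

* §1 **`nonempty_twistMod_one_id_iso_lineBundle_hyperplane`** — on `𝐏ᵈ_K` itself, `𝒪(1) := twistMod (𝟙 𝐏ᵈ) 𝒪 1 ≅ 𝒪(H)`
  (`𝒪(1)` is the line bundle of a hyperplane: the `m = 1`, `ι = 𝟙` case of ★ `SerreTwist.nonempty_dual_serreTwist_iso_lineBundle`,
  [Hartshorne1977] II Prop. 5.12, [GortzWedhorn2020] Prop. 11.21);
* §2 **`exists_isAmple_nonempty_twistMod_one_iso_lineBundle`** — for `Y` integral and `ι : Y → 𝐏ᵈ_K` AFFINE (e.g. a closed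
  immersion), `𝒪_Y(1) := twistMod ι 𝒪_Y 1 ≅ 𝒪_Y(Θ)` for an AMPLE Cartier divisor `Θ` on `Y` ([GortzWedhorn2020] Prop. 13.66 (2):
  `ι` affine and `𝒪(1)` ample ⇒ `ι^*𝒪(1)` ample; ★ S1b `CartierDivisor.exists_isAmple_nonempty_pullback_iso_of_iso_hyperplane`, ★
  `SerreTwist.isIso_pullbackTwistHom`: `ι^*𝒪_{𝐏}(1) ≅ 𝒪_Y(1)`);
* §3 **`exists_isAmple_nonempty_pullback_twistMod_one_iso_lineBundle_of_sq`** — the FIBRE form: in a commutative square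
  `k ≫ ιZ = ιK ≫ (𝐏ʳ_L → 𝐏ʳ_K)` (a family `Z ⊂ 𝐏ʳ_K` and, say, its fibre `X₀ ⊂ 𝐏ʳ_L` over an `L`-valued point, `L` a field),
  with `X₀` integral and `ιK` affine, `k^*𝒪_Z(1) ≅ 𝒪_{X₀}(Θ)` for an ample `Θ` (★ `SerreTwist.exists_pullback_twistMod_iso_of_sq`:
  `k^*𝒪_Z(1) ≅ 𝒪_{X₀}(1)`, then §2) — [MumfordFogartyKirwan1994] Prop. 7.3, proof, step (V): «`L₄ = 𝒪_Z ⊗ p₁^*(𝒪_{ℙ_m}(1))`» is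
  ample on every fibre.

## References
* R. Hartshorne, *Algebraic Geometry*, GTM 52 (1977): II Prop. 5.12 (b), (c) (p. 117) (`𝒪(n)`, `f^*𝒪(n)`). [Hartshorne1977]
* U. Görtz, T. Wedhorn, *Algebraic Geometry I: Schemes*, 2nd ed. (2020): Prop. 11.21 (p. 302) (`𝒪_X(D)` and its class),
  Prop. 13.66 (2) (p. 402) and Example 13.45 (pull-back of an ample line bundle along an affine morphism), (13.9) (p. 387)
  (`ℙⁿ_S ×_S S' = ℙⁿ_{S'}`). [GortzWedhorn2020]
* D. Mumford, J. Fogarty, F. Kirwan, *Geometric Invariant Theory*, 3rd ed. (1994), Ch. 7 §2 Prop. 7.3, proof, step (V) (p. 134).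
  [MumfordFogartyKirwan1994]
-/

noncomputable section

set_option backward.isDefEq.respectTransparency false

open CategoryTheory CategoryTheory.Limits AlgebraicGeometry TopologicalSpace Opposite
open Literature.AlgebraicGeometry.Morphisms Literature.AlgebraicGeometry.Morphisms.ProjCech
open Literature.AlgebraicGeometry.Motives

universe u

-- Mathlib keeps `MvPolynomial.gradedAlgebra` a `def`; made an instance locally as in the tree's `Proj k[x₀,…,x_n]` files
-- (★ `Modules/SerreTwistHyperplaneClass`, ★ `Modules/SerreTwistModProjMap`).
attribute [local instance] MvPolynomial.gradedAlgebra

namespace Literature.AlgebraicGeometry.Modules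

namespace SerreTwist

/-! ## §1 `𝒪_{𝐏ᵈ_K}(1) ≅ 𝒪(H)` -/

section ProjectiveSpace

variable (d : ℕ) (K : Type u) [Field K]

/-- **`𝒪_{𝐏ᵈ_K}(1)` is the line bundle of the hyperplane divisor**: the positive Serre twist `twistMod (𝟙 𝐏ᵈ_K) 𝒪 1` is isomorphic
to `𝒪(H)`, `H = div(x₀)` (★ `ProjSpace.hyperplane`).  Indeed `𝒪(1) ≅ 𝓗om(𝒪(-1), 𝒪) = 𝒪(-1)^∨` (★ `sheafHomTwistIso`) and
`𝒪(-1)^∨ ≅ 𝒪(1 • H_{𝟙}) = 𝒪(H)` (★ `nonempty_dual_serreTwist_iso_lineBundle` on the integral scheme `𝐏ᵈ_K`, ★ `CartierDivisor.one_smul`).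
[cite: Hartshorne1977, II Prop. 5.12 (p. 117)] [cite: GortzWedhorn2020, Prop. 11.21 (p. 302)] -/
theorem nonempty_twistMod_one_id_iso_lineBundle_hyperplane :
    Nonempty (twistMod (𝟙 (ProjSpace.P d K)) (unitModule (ProjSpace.P d K)) 1 ≅
      lineBundle (ProjSpace.hyperplane d K).toUnitCocycle) := by
  obtain ⟨e⟩ := nonempty_dual_serreTwist_iso_lineBundle (𝟙 (ProjSpace.P d K)) 1 0 (ProjSpace.genericPoint_mem_U 0)
  -- `𝒪(1 • H) = 𝒪(H)`
  have e' : lineBundle (1 • ProjSpace.hyperplane d K).toUnitCocycle ≅ lineBundle (ProjSpace.hyperplane d K).toUnitCocycle :=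
    eqToIso (by rw [CartierDivisor.one_smul])
  exact ⟨(sheafHomTwistIso (𝟙 (ProjSpace.P d K)) (unitModule (ProjSpace.P d K)) 1).symm ≪≫ e ≪≫ e'⟩

end ProjectiveSpace

/-! ## §2 `𝒪_Y(1) ≅ 𝒪_Y(Θ)` with `Θ` ample, for `ι : Y → 𝐏ᵈ_K` affine -/

section Affine

variable {d : ℕ} {K : Type u} [Field K] {Y : Scheme.{u}} [IsIntegral Y] (ι : Y ⟶ ProjSpace.P d K) [IsAffineHom ι]

/-- **`𝒪_Y(1) ≅ 𝒪_Y(Θ)` for an AMPLE Cartier divisor `Θ`**, for `Y` integral and `ι : Y → 𝐏ᵈ_K` affine (e.g. a closed immersion):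
`𝒪_Y(1) := twistMod ι 𝒪_Y 1 ≅ ι^*𝒪_{𝐏}(1)` (★ `isIso_pullbackTwistHom`, [Hartshorne1977] II Prop. 5.12 (c)), `𝒪_{𝐏}(1) ≅ 𝒪(H)` (§1),
and the pull-back of the ample `𝒪(H)` along the affine `ι` is `𝒪_Y(Θ)` with `Θ` ample (★ S1b
`CartierDivisor.exists_isAmple_nonempty_pullback_iso_of_iso_hyperplane`, [GortzWedhorn2020] Prop. 13.66 (2)).
[cite: GortzWedhorn2020, Prop. 13.66 (2) (p. 402) and Example 13.45] [cite: Hartshorne1977, II Prop. 5.12 (c) (p. 117)] -/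
theorem exists_isAmple_nonempty_twistMod_one_iso_lineBundle :
    ∃ Θ : CartierDivisor Y, Θ.IsAmple ∧ Nonempty (twistMod ι (unitModule Y) 1 ≅ lineBundle Θ.toUnitCocycle) := by
  obtain ⟨φ⟩ := nonempty_twistMod_one_id_iso_lineBundle_hyperplane d K
  obtain ⟨Θ, hΘ, ⟨ψ⟩⟩ := CartierDivisor.exists_isAmple_nonempty_pullback_iso_of_iso_hyperplane ι φ
  haveI := isIso_pullbackTwistHom ι (𝟙 (ProjSpace.P d K)) 1
  -- `ι^*𝒪_{𝐏}(1) ≅ 𝒪_Y(1)` computed through `ι ≫ 𝟙 = ι`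
  have e₁ : twistMod (ι ≫ 𝟙 (ProjSpace.P d K)) (unitModule Y) 1 ≅ twistMod ι (unitModule Y) 1 :=
    eqToIso (by rw [Category.comp_id])
  exact ⟨Θ, hΘ, ⟨e₁.symm ≪≫ (asIso (pullbackTwistHom ι (𝟙 (ProjSpace.P d K)) 1)).symm ≪≫ ψ⟩⟩

end Affine

/-! ## §3 The fibre form: `k^*𝒪_Z(1) ≅ 𝒪_{X₀}(Θ)` with `Θ` ample, in a square over `𝐏ʳ_L → 𝐏ʳ_K` -/

section Square

variable (K L : Type u) [CommRing K] [Field L] [Algebra K L] {r : ℕ} {X₀ Z : Scheme.{u}}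
  (k : X₀ ⟶ Z) (ιZ : Z ⟶ PP K r) (ιK : X₀ ⟶ PP L r)
  (w : k ≫ ιZ = ιK ≫ Proj.map (ProjBaseChangeRing.mapGraded K L (Fin (r + 1)))
    (ProjBaseChangeRing.irrelevant_le_map K L (Fin (r + 1))))
  [IsIntegral X₀] [IsAffineHom ιK]

include w in
/-- **THE FIBRE FORM** ([MumfordFogartyKirwan1994] Prop. 7.3, proof, step (V): `p₁^*𝒪_{ℙ_m}(1)` is ample on every fibre of an
embedded family).  In a commutative square `k ≫ ιZ = ιK ≫ (𝐏ʳ_L → 𝐏ʳ_K)` — a family `ιZ : Z → 𝐏ʳ_K` and, for instance, its fibre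
`ιK : X₀ → 𝐏ʳ_L` over an `L`-valued point of the base, `L` a field — with `X₀` integral and `ιK` affine, the pull-back of
`𝒪_Z(1) := twistMod ιZ 𝒪_Z 1` to `X₀` is `𝒪_{X₀}(Θ)` for an AMPLE Cartier divisor `Θ`: `k^*𝒪_Z(1) ≅ 𝒪_{X₀}(1)` (★
`exists_pullback_twistMod_iso_of_sq`, [Hartshorne1977] II Prop. 5.12 (c)) and §2.
[cite: MumfordFogartyKirwan1994, Ch. 7 §2 Prop. 7.3, proof, step (V) (p. 134)] [cite: GortzWedhorn2020, Prop. 13.66 (2) (p. 402) and (13.9) (p. 387)]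
[cite: Hartshorne1977, II Prop. 5.12 (c) (p. 117)] -/
theorem exists_isAmple_nonempty_pullback_twistMod_one_iso_lineBundle_of_sq :
    ∃ Θ : CartierDivisor X₀, Θ.IsAmple ∧
      Nonempty ((Scheme.Modules.pullback k).obj (twistMod ιZ (unitModule Z) 1) ≅ lineBundle Θ.toUnitCocycle) := by
  obtain ⟨φ, -, -⟩ := exists_pullback_twistMod_iso_of_sq K L k ιZ ιK w 1
  obtain ⟨Θ, hΘ, ⟨ψ⟩⟩ := exists_isAmple_nonempty_twistMod_one_iso_lineBundle ιK
  exact ⟨Θ, hΘ, ⟨φ ≪≫ ψ⟩⟩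

end Square

end SerreTwist

end Literature.AlgebraicGeometry.Modules

end
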